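import Summits.CriticalPhenomena.PercolationContinuityZ3.Theorems.Transplant.FreeNilpotentCylSubcritical
import Summits.CriticalPhenomena.PercolationContinuityZ3.Theorems.Transplant.HeisenbergCarriers
import Summits.CriticalPhenomena.PercolationContinuityZ3.Theorems.Transplant.SkeletonDropNode
import HarnessLib

/-!
# `N_{2,2} = H₃(ℤ)`: the rank-2 member of the free family is the lane's Heisenberg Cayley graph; `θ(p_c) = 0` on `Cay(N_{m,2})` for EVERY `m ≥ 2` from the node

builds on p205010 (kernel theorem, internal audit signed; external expert review pending) — nothing in this file uses p205010.
Lane `prim-bschramm`, seat `prim-bschramm-p4` (gen 4; class map, memo `P4-GENERAL.md` §12), helper file (`--supports stmt-CriticalPhenomena-4575`).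

`fnGraph 2` (Mal'cev coordinates `(v₀, v₁; c_{(0,1)})`, cocycle `v₀ v'₁`) and p3's `Heisenberg.heisenbergGraph` (`(a,b,c)·(a',b',c') = (a+a', b+b', c+c'+ab')`
on `Fin 3 → ℤ`) are the SAME right Cayley graph: `fn2Iso : fnGraph 2 ≃g heisenbergGraph`, `(v,c) ↦ (v₀, v₁, c_{(0,1)})`.  Hence `θ`, `p_c` agree at `1`
and the `m = 2` case of the free family is the lane's tier 1b (cylinders subcritical by bounded cutsets, `heisenbergCriticalContinuity_of_dropNode`, p219198):
**`freeNilpotent_criticalContinuity_all_ranks : SamePDropOfSkeletonRank → ∀ m ≥ 2, θ_{Cay N_{m,2}}(1, p_c) = 0`** (m = 2 through the planar node it contains,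
m ≥ 3 by `FreeNilpotentCylSubcritical.lean`).
[cite: BenjaminiSchramm1996, Conj. 4] [cite: ContrerasMartineauTassion2024, §1.1 (the Heisenberg example)] [cite: KozmaNitzan2024, §1 p. 2 (approach 1)]
-/

noncomputable section

namespace Summit.CriticalPhenomena.PercolationContinuityZ3.Theorems.Transplant

open MeasureTheory Literature.Probability.Percolation Literature.Probability.LatticeModels
open Summit.CriticalPhenomena.PercolationContinuityZ3.Theorems.Heisenberg (HV heisMul genA genB heisenbergGraph heisenbergGraph_adj)

/-! ## §1 The carrier identification `FN 2 ≃ (Fin 3 → ℤ)` -/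

/-- The only ordered pair of `Fin 2`. [folklore] -/
def pr01 : Pr 2 := ⟨(0, 1), by decide⟩

/-- `Pr 2` has exactly one element. [folklore] -/
theorem pr_two_eq (p : Pr 2) : p = pr01 := by
  obtain ⟨⟨a, b⟩, hab⟩ := p
  have h : a.val < b.val := hab
  have ha := a.isLt
  have hb := b.isLt
  refine Subtype.ext (Prod.ext (Fin.ext ?_) (Fin.ext ?_))
  · show a.val = 0; omega
  · show b.val = 1; omega

/-- `(v, c) ↦ (v₀, v₁, c_{(0,1)})`. [folklore] -/
def fn2Equiv : FN 2 ≃ HV where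
  toFun x := ![x.1 0, x.1 1, x.2 pr01]
  invFun y := (![y 0, y 1], fun _ => y 2)
  left_inv x := by
    refine Prod.ext (funext fun i => ?_) (funext fun p => ?_)
    · fin_cases i <;> rfl
    · rw [pr_two_eq p]; rfl
  right_inv y := by funext i; fin_cases i <;> rfl

/-- `fn2Equiv` in coordinates. [folklore] -/
@[simp] theorem fn2Equiv_apply (x : FN 2) : fn2Equiv x = ![x.1 0, x.1 1, x.2 pr01] := rfl

/-- Right multiplication by `e₀` corresponds to right multiplication by `A`. [folklore] -/
theorem fn2Equiv_mul_gen0 (x : FN 2) : fn2Equiv (fnMul x (fnGen 0)) = heisMul (fn2Equiv x) genA := by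
  funext i; fin_cases i <;> simp [heisMul, genA, pr01]

/-- Right multiplication by `e₁` corresponds to right multiplication by `B`. [folklore] -/
theorem fn2Equiv_mul_gen1 (x : FN 2) : fn2Equiv (fnMul x (fnGen 1)) = heisMul (fn2Equiv x) genB := by
  funext i; fin_cases i <;> simp [heisMul, genB, pr01]

/-- The generating relations correspond. [folklore] -/
theorem fn2_rel_iff (x y : FN 2) :
    (∃ i : Fin 2, y = fnMul x (fnGen i)) ↔ (fn2Equiv y = heisMul (fn2Equiv x) genA ∨ fn2Equiv y = heisMul (fn2Equiv x) genB) := by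
  rw [Fin.exists_fin_two, ← fn2Equiv_mul_gen0, ← fn2Equiv_mul_gen1, fn2Equiv.injective.eq_iff, fn2Equiv.injective.eq_iff]

/-- **`Cay(N_{2,2}; e₀, e₁) ≃g Cay(H₃(ℤ); A, B)`** (p3's carrier `Fin 3 → ℤ`). [cite: ContrerasMartineauTassion2024, §1.1] -/
def fn2Iso : fnGraph 2 ≃g heisenbergGraph where
  toEquiv := fn2Equiv
  map_rel_iff' := by
    intro x y
    rw [heisenbergGraph_adj]
    show _ ↔ (fnGraph 2).Adj x y
    rw [fnGraph, SimpleGraph.fromRel_adj, fn2Equiv.injective.ne_iff, fn2_rel_iff, fn2_rel_iff]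

/-- The isomorphism fixes the identity. [folklore] -/
theorem fn2Iso_zero : fn2Iso (0 : FN 2) = (0 : HV) := by
  show fn2Equiv 0 = 0
  funext i; fin_cases i <;> rfl

/-! ## §2 Consequences: `θ`, `p_c` agree; the `m = 2` case and all ranks -/

/-- `θ` at `1` agrees on the two carriers. [folklore] -/
theorem theta_fnGraph_two (p : unitInterval) : theta (fnGraph 2) 0 p = theta heisenbergGraph 0 p := by
  have h := theta_iso fn2Iso (0 : FN 2) p
  rw [fn2Iso_zero] at h
  exact h.symm

/-- `p_c` at `1` agrees on the two carriers. [folklore] -/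
theorem criticalProbIOf_fnGraph_two : criticalProbIOf (fnGraph 2) 0 = criticalProbIOf heisenbergGraph 0 := by
  apply Subtype.ext
  change criticalProb (fnGraph 2) 0 = criticalProb heisenbergGraph 0
  have h := criticalProb_iso fn2Iso (0 : FN 2)
  rw [fn2Iso_zero] at h
  exact h.symm

/-- **`θ_{Cay N_{2,2}}(p_c) = 0` is the lane's `HeisenbergCriticalContinuity`.** [cite: BenjaminiSchramm1996, Conj. 4] -/
theorem freeNilpotent_two_criticalContinuity_iff :
    theta (fnGraph 2) 0 (criticalProbIOf (fnGraph 2) 0) = 0 ↔ Heisenberg.HeisenbergCriticalContinuity := by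
  unfold Heisenberg.HeisenbergCriticalContinuity
  rw [criticalProbIOf_fnGraph_two, theta_fnGraph_two]

/-- **`m = 2` from the PLANAR drop node** (tier 1b: cylinders of `H₃` subcritical at every `p < 1` by bounded cutsets).
[cite: BenjaminiSchramm1996, Conj. 4] [cite: KozmaNitzan2024, §1 p. 2 (approach 1)] -/
theorem freeNilpotent_two_criticalContinuity_of_dropNode (hD : SamePDropOfSkeleton) :
    theta (fnGraph 2) 0 (criticalProbIOf (fnGraph 2) 0) = 0 :=
  freeNilpotent_two_criticalContinuity_iff.2 (heisenbergCriticalContinuity_to_p3 (heisenbergCriticalContinuity_of_dropNode hD))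

/-- **`θ(p_c) = 0` on `Cay(N_{m,2})` for EVERY `m ≥ 2`, conditional on the rank node `SamePDropOfSkeletonRank` only.**
[cite: BenjaminiSchramm1996, Conj. 4] [cite: KozmaNitzan2024, §4] -/
theorem freeNilpotent_criticalContinuity_all_ranks (hD : SamePDropOfSkeletonRank) (m : ℕ) (hm : 2 ≤ m) :
    theta (fnGraph m) 0 (criticalProbIOf (fnGraph m) 0) = 0 := by
  rcases Nat.eq_or_lt_of_le hm with h | h
  · subst h
    exact freeNilpotent_two_criticalContinuity_of_dropNode (samePDropOfSkeleton_of_rank hD)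
  · exact freeNilpotent_criticalContinuity_of_dropNodeRank hD m h

end Summit.CriticalPhenomena.PercolationContinuityZ3.Theorems.Transplant

end
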